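import Summits.Ventures.HodgeRepro2.T5TorusCharacters

/-!
# T5HaarCircle — the normalised Haar measure of the circle group is `dθ / 2π`

Support (seat p1, blind lane) for route/T5-N4-p5.md v10 (N4.3 = (R3)) — the measure behind the
S4 rows «the SO(2)-weights …» / «Schur orthogonality» and the S4 last-column item «that Rühl's
measure IS Haar measure» in its compact-factor form: the push-forward `haarCircle` of Mathlib's
normalised Haar measure `AddCircle.haarAddCircle` on `ℝ/2πℤ` under `θ ↦ exp(iθ)` is a
left-invariant probability measure on `Circle`, its integrals are `(2π)⁻¹ ∫₀^{2π} f(e^{iθ}) dθ`,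
and the characters `z ↦ z ^ n` are orthonormal for it (T5TorusCharacters' explicit integral).

Main statements:
* `haarCircle` — the measure; `instIsProbabilityMeasure`, `instIsMulLeftInvariant`;
* `integral_haarCircle` — `∫ f ∂haarCircle = (2π)⁻¹ • ∫ θ in 0..2π, f (exp(iθ))`;
* `integral_zpow_mul_conj_zpow` — `∫ z ^ m · conj (z ^ n) ∂haarCircle = [m = n]`.

Honest scope: `Circle` stands for SO(2) ⊂ SU(1,1) through T5CayleySU11's matrix parametrisation
(not re-proved here); Haar measure on the NON-compact group U(1,1) / SU(1,1) and Rühl's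
normalisation `½ sinh η dη (4π)⁻² dψ₁ dψ₂` are NOT addressed.
-/

namespace Summit.Ventures.HodgeRepro2.T5HaarCircle

open MeasureTheory Real Complex

/-- `0 < 2π`, as a `Fact` (Mathlib's `AddCircle T` results ask for `Fact (0 < T)`). -/
instance fact_two_pi_pos : Fact (0 < 2 * π) := ⟨by positivity⟩

section Measure

variable [MeasurableSpace Circle] [BorelSpace Circle]

/-- The normalised Haar measure on `Circle`: the push-forward of `AddCircle.haarAddCircle` on
`ℝ/2πℤ` (total mass 1) under the group isomorphism `θ ↦ exp(iθ)`. -/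
noncomputable def haarCircle : Measure Circle :=
  Measure.map AddCircle.homeomorphCircle' (@AddCircle.haarAddCircle (2 * π) _)

/-- The group isomorphism `ℝ/2πℤ ≅ Circle` is measurable (it is a homeomorphism). -/
theorem measurable_homeomorphCircle' :
    Measurable (AddCircle.homeomorphCircle' : AddCircle (2 * π) → Circle) :=
  AddCircle.homeomorphCircle'.continuous.measurable

/-- `haarCircle` is a probability measure (push-forward of a probability measure). -/
instance instIsProbabilityMeasure : IsProbabilityMeasure haarCircle :=
  Measure.isProbabilityMeasure_map measurable_homeomorphCircle'.aemeasurable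

/-- `haarCircle` is left-invariant: translation by `exp(ix)` on `Circle` is conjugate to
translation by `x` on `ℝ/2πℤ`, under which `haarAddCircle` is invariant. -/
instance instIsMulLeftInvariant : haarCircle.IsMulLeftInvariant := by
  refine ⟨fun g => ?_⟩
  obtain ⟨x, rfl⟩ := AddCircle.homeomorphCircle'.surjective g
  rw [haarCircle, Measure.map_map (measurable_const_mul _) measurable_homeomorphCircle']
  conv_rhs => rw [← MeasureTheory.map_add_left_eq_self (@AddCircle.haarAddCircle (2 * π) _) x]
  rw [Measure.map_map measurable_homeomorphCircle' (measurable_const_add _)]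
  congr 1
  funext y
  simp only [Function.comp_apply, AddCircle.homeomorphCircle'_apply]
  exact (Real.Angle.toCircle_add x y).symm

/-- Integration against `haarCircle` is `(2π)⁻¹ ∫₀^{2π} f(e^{iθ}) dθ`. -/
theorem integral_haarCircle {E : Type*} [NormedAddCommGroup E] [NormedSpace ℝ E]
    (f : Circle → E) :
    ∫ z, f z ∂haarCircle = (2 * π)⁻¹ • ∫ θ in (0 : ℝ)..2 * π, f (Circle.exp θ) := by
  have h1 : haarCircle = Measure.map (AddCircle.homeomorphCircle'.toMeasurableEquiv)
      (@AddCircle.haarAddCircle (2 * π) _) := rfl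
  rw [h1, integral_map_equiv, AddCircle.integral_haarAddCircle]
  congr 1
  rw [← AddCircle.intervalIntegral_preimage (2 * π) 0, zero_add]
  apply intervalIntegral.integral_congr
  intro θ _
  simp only [Homeomorph.toMeasurableEquiv_coe, AddCircle.homeomorphCircle'_apply_mk]

/-- The characters `z ↦ z ^ n` are orthonormal for `haarCircle`:
`∫ z ^ m · conj (z ^ n) ∂haarCircle = [m = n]`. -/
theorem integral_zpow_mul_conj_zpow (m n : ℤ) :
    ∫ z, (z : ℂ) ^ m * (starRingEnd ℂ) ((z : ℂ) ^ n) ∂haarCircle = if m = n then 1 else 0 := by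
  rw [integral_haarCircle (fun z : Circle => (z : ℂ) ^ m * (starRingEnd ℂ) ((z : ℂ) ^ n))]
  simp only [Circle.coe_exp]
  simp_rw [← Complex.exp_int_mul]
  rw [← T5TorusCharacters.integral_exp_mul_conj_exp_div m n, Complex.real_smul]
  push_cast
  rfl

/-- The total mass is `1` (restated for citation). -/
theorem haarCircle_univ : haarCircle (Set.univ : Set Circle) = 1 := measure_univ

end Measure

end Summit.Ventures.HodgeRepro2.T5HaarCircle
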